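import Summits.QuantumFields.YangMills.Theorems.SmallFieldWideningWideningOfTiltAndMassTVLaw
import Literature.MathematicalPhysics.QuantumFieldTheory.Balaban1983to89.T3UnitLawGaugeInvariance
import Literature.MathematicalPhysics.QuantumFieldTheory.Balaban1983to89.T3CentreTwistUnitLaw

/-!
# Route `SmallFieldWidening` — THE TOTAL-VARIATION LIMIT UNIT LAW IS UNIQUE, GAUGE INVARIANT AND CENTRE SYMMETRIC
# (support of item `WideningOfTiltAndMass`, stmt-QuantumFields-22885; helper, route-independent)

WHAT THIS IS NOT: not E3, not a crux of the route, not d = 4, not a mass gap, not Clay; no summit is proved.  Everything is keyed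
on a TOTAL-VARIATION LIMIT HYPOTHESIS for the unit laws (which the sibling files derive from the item's hypotheses:
`WideningTVLaw.exists_limitUnitLaw_TV`; and from K1 ∧ K2 with summable rates: `WideningTVTail`).

WHAT IT IS — the `ℰp`-twin, in total variation, of the tree's weak-limit package `T3ContinuumUnitLaw` (which needs the CONTINUOUS
smearing `ℰc`; the printed `ℰp` is only measurable, so weak convergence is not available there, but total variation is stronger and
topology-free):
* §1 (pure measure theory).  Total-variation limits over measurable `|g| ≤ 1` are UNIQUE among finite measures
  (`eq_of_tvLimit`), and INHERIT every measurable symmetry of the approximating laws (`map_eq_of_tvLimit`: if `T_* Q_J = Q_J`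
  for all `J` and `Q_J → ν` in total variation then `T_* ν = ν`, because `T_* ν` is again a total-variation limit of `T_* Q_J = Q_J`).
* §2 (`SU(2)`, printed smearing `ℰp`, `γ ≥ 0`).  ANY total-variation limit `ν` of the unit laws `unitLaw F ℰp γ J` is GAUGE
  INVARIANT (`map_gaugeAct_eq_of_tvLimit`, from the tree's `map_gaugeAct_unitLaw`) and CENTRE SYMMETRIC under every central twist
  (`map_ctwist_eq_of_tvLimit`, from `map_ctwist_unitLaw`); under the item's hypotheses such a `ν` exists, is a probability law,
  is absolutely continuous with respect to product Haar, and is unique (`exists_unique_limitUnitLaw`).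
-/

noncomputable section

open MeasureTheory Filter Topology
open scoped ENNReal
open Literature.MathematicalPhysics.QuantumFieldTheory.Balaban1983to89
open Literature.MathematicalPhysics.QuantumFieldTheory.Balaban1983to89.Missing
open Literature.MathematicalPhysics.QuantumFieldTheory.Balaban1983to89.T3ContinuumYM3Torus
open Literature.MathematicalPhysics.QuantumFieldTheory.Balaban1983to89.T3ThresholdRemoval
open Literature.MathematicalPhysics.QuantumFieldTheory.Balaban1983to89.T3UnitLawDensityEML
open Literature.MathematicalPhysics.QuantumFieldTheory.Balaban1983to89.T3UnitScaleTilt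
open Literature.MathematicalPhysics.QuantumFieldTheory.Balaban1983to89.T3UnitLawGaugeInvariance
open Literature.MathematicalPhysics.QuantumFieldTheory.Balaban1983to89.T3CentreTwistUnitLaw
open Literature.MathematicalPhysics.QuantumFieldTheory.Balaban1983to89.B12RTGaugeInvariance254 (measurable_gaugeAct)
open Summit.QuantumFields.YangMills.Theorems.WideningTVLaw

namespace Summit.QuantumFields.YangMills.Theorems.WideningTVSym

/-! ## §1 Pure measure theory: total-variation limits are unique and inherit measurable symmetries -/

section Abstract

variable {X : Type*} [MeasurableSpace X]

/-- Two finite measures with equal integrals of all measurable `|g| ≤ 1` are equal (indicators; local form). -/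
theorem measure_ext_of_forall_integral_eq {ν ν' : Measure X} [IsFiniteMeasure ν] [IsFiniteMeasure ν']
    (h : ∀ g : X → ℝ, Measurable g → (∀ x, |g x| ≤ 1) → ∫ x, g x ∂ν = ∫ x, g x ∂ν') : ν = ν' := by
  refine Measure.ext fun s hs => ?_
  have hb : ∀ y, |s.indicator (1 : X → ℝ) y| ≤ 1 := fun y => by
    by_cases hy : y ∈ s
    · simp [hy]
    · simp [hy]
  have h1 := h _ (measurable_one.indicator hs) hb
  rw [integral_indicator_one hs, integral_indicator_one hs] at h1
  exact (ENNReal.toReal_eq_toReal_iff' (measure_ne_top _ _) (measure_ne_top _ _)).mp h1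

/-- **TOTAL-VARIATION LIMITS ARE UNIQUE**: if the laws `Q_J` are eventually `ε`-close to `ν` and to `ν'` uniformly over measurable
`|g| ≤ 1`, for every `ε > 0`, then the finite measures `ν`, `ν'` coincide. -/
theorem eq_of_tvLimit (Q : ℕ → Measure X) {ν ν' : Measure X} [IsFiniteMeasure ν] [IsFiniteMeasure ν']
    (hν : ∀ ε : ℝ, 0 < ε → ∃ J₀ : ℕ, ∀ J : ℕ, J₀ ≤ J → ∀ g : X → ℝ, Measurable g → (∀ x, |g x| ≤ 1) →
      |(∫ x, g x ∂Q J) - ∫ x, g x ∂ν| ≤ ε)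
    (hν' : ∀ ε : ℝ, 0 < ε → ∃ J₀ : ℕ, ∀ J : ℕ, J₀ ≤ J → ∀ g : X → ℝ, Measurable g → (∀ x, |g x| ≤ 1) →
      |(∫ x, g x ∂Q J) - ∫ x, g x ∂ν'| ≤ ε) : ν = ν' := by
  refine measure_ext_of_forall_integral_eq fun g hgm hg1 => eq_of_forall_dist_le fun ε hε => ?_
  obtain ⟨J₀, hJ₀⟩ := hν (ε / 2) (half_pos hε)
  obtain ⟨J₀', hJ₀'⟩ := hν' (ε / 2) (half_pos hε)
  have h1 := hJ₀ (max J₀ J₀') (le_max_left _ _) g hgm hg1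
  have h2 := hJ₀' (max J₀ J₀') (le_max_right _ _) g hgm hg1
  rw [Real.dist_eq]
  calc |(∫ x, g x ∂ν) - ∫ x, g x ∂ν'|
      = |((∫ x, g x ∂Q (max J₀ J₀')) - ∫ x, g x ∂ν') - ((∫ x, g x ∂Q (max J₀ J₀')) - ∫ x, g x ∂ν)| := by
        congr 1; ring
    _ ≤ |(∫ x, g x ∂Q (max J₀ J₀')) - ∫ x, g x ∂ν'| + |(∫ x, g x ∂Q (max J₀ J₀')) - ∫ x, g x ∂ν| := abs_sub _ _
    _ ≤ ε := by linarith

/-- **TOTAL-VARIATION LIMITS INHERIT MEASURABLE SYMMETRIES**: if a measurable map `T` preserves every law `Q_J` and `Q_J → ν` in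
total variation (uniformly over measurable `|g| ≤ 1`), then `T` preserves the finite measure `ν` — `T_* ν` is again a
total-variation limit of `T_* Q_J = Q_J` (`g ∘ T` is measurable and bounded by `1`), and such limits are unique. -/
theorem map_eq_of_tvLimit (Q : ℕ → Measure X) {ν : Measure X} [IsFiniteMeasure ν] {T : X → X} (hT : Measurable T)
    (hQ : ∀ J, (Q J).map T = Q J)
    (hν : ∀ ε : ℝ, 0 < ε → ∃ J₀ : ℕ, ∀ J : ℕ, J₀ ≤ J → ∀ g : X → ℝ, Measurable g → (∀ x, |g x| ≤ 1) →
      |(∫ x, g x ∂Q J) - ∫ x, g x ∂ν| ≤ ε) : ν.map T = ν := by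
  haveI : IsFiniteMeasure (ν.map T) := Measure.isFiniteMeasure_map ν T
  refine eq_of_tvLimit Q (fun ε hε => ?_) hν
  obtain ⟨J₀, hJ₀⟩ := hν ε hε
  refine ⟨J₀, fun J hJ g hgm hg1 => ?_⟩
  rw [integral_map hT.aemeasurable hgm.aestronglyMeasurable, ← hQ J,
    integral_map hT.aemeasurable hgm.aestronglyMeasurable]
  exact hJ₀ J hJ (fun x => g (T x)) (hgm.comp hT) (fun x => hg1 _)

end Abstract

/-! ## §2 `SU(2)`, printed smearing: every total-variation limit of the unit laws is gauge invariant and centre symmetric -/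

section UnitLaw

variable (F : T3Family)

/-- **GAUGE INVARIANCE OF THE LIMIT UNIT LAW** (`SU(2)`, `ℰp`, `γ ≥ 0`): any finite measure `ν` to which the unit laws
`unitLaw F ℰp γ J` converge in total variation is invariant under every gauge transformation of the unit torus (each unit law is,
tree `map_gaugeAct_unitLaw`; §1). -/
theorem map_gaugeAct_eq_of_tvLimit {γ : ℝ} (hγ : 0 ≤ γ)
    {ν : Measure (GaugeField (F.P 0) 0 (Matrix.specialUnitaryGroup (Fin 2) ℂ))} [IsFiniteMeasure ν]
    (hν : ∀ ε : ℝ, 0 < ε → ∃ J₀ : ℕ, ∀ J : ℕ, J₀ ≤ J →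
      ∀ g : GaugeField (F.P 0) 0 (Matrix.specialUnitaryGroup (Fin 2) ℂ) → ℝ, Measurable g → (∀ u, |g u| ≤ 1) →
        |(∫ u, g u ∂F.unitLaw ℰp measurableE_ℰp γ J) - ∫ u, g u ∂ν| ≤ ε)
    (v : GaugeTransf (F.P 0) 0 (Matrix.specialUnitaryGroup (Fin 2) ℂ)) :
    ν.map (GaugeField.gaugeAct v) = ν :=
  map_eq_of_tvLimit (fun J => F.unitLaw ℰp measurableE_ℰp γ J) (measurable_gaugeAct v)
    (fun J => map_gaugeAct_unitLaw F ℰp measurableE_ℰp hγ J v) hν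

/-- **CENTRE SYMMETRY OF THE LIMIT UNIT LAW** (`SU(2)`, `ℰp`, `γ ≥ 0`): any finite total-variation limit `ν` of the unit laws is
invariant under every centre twist `ctwist z μ s` (central `z`, axis `μ`, slice `s` of the unit torus; each unit law is, tree
`map_ctwist_unitLaw`; §1). -/
theorem map_ctwist_eq_of_tvLimit {γ : ℝ} (hγ : 0 ≤ γ)
    {ν : Measure (GaugeField (F.P 0) 0 (Matrix.specialUnitaryGroup (Fin 2) ℂ))} [IsFiniteMeasure ν]
    (hν : ∀ ε : ℝ, 0 < ε → ∃ J₀ : ℕ, ∀ J : ℕ, J₀ ≤ J →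
      ∀ g : GaugeField (F.P 0) 0 (Matrix.specialUnitaryGroup (Fin 2) ℂ) → ℝ, Measurable g → (∀ u, |g u| ≤ 1) →
        |(∫ u, g u ∂F.unitLaw ℰp measurableE_ℰp γ J) - ∫ u, g u ∂ν| ≤ ε)
    {z : Matrix.specialUnitaryGroup (Fin 2) ℂ} (hz : ∀ g : Matrix.specialUnitaryGroup (Fin 2) ℂ, z * g = g * z)
    (μ : Fin 3) (s : ZMod ((F.P 0).sitesPerDir 0)) :
    ν.map (GaugeField.ctwist z μ s) = ν :=
  map_eq_of_tvLimit (fun J => F.unitLaw ℰp measurableE_ℰp γ J) (GaugeField.measurePreserving_ctwist z μ s).measurable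
    (fun J => map_ctwist_unitLaw F ℰp measurableE_ℰp hz hγ J μ s) hν

/-- **UNDER THE ITEM'S HYPOTHESES: THE LIMIT UNIT LAW EXISTS, IS UNIQUE, ABSOLUTELY CONTINUOUS, GAUGE INVARIANT AND CENTRE
SYMMETRIC** (`SU(2)`, `ℰp`; all-heights unit tilt at every refinement depth `n ≥ n₀` and ONE `K`-uniform large-field mass
`δ n → 0`, i.e. the r2- and r3-instances — neither is proved here): there is exactly one probability law `ν` on the unit-torus
gauge fields to which `unitLaw F ℰp γ J` converges in total variation; it has a density with respect to product Haar, and every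
gauge transformation and every central twist preserves it.  No crux and no summit is proved here. -/
theorem exists_unique_limitUnitLaw {γ b₀ p₀ : ℝ} (n₀ : ℕ) (hγ : 0 < γ)
    (hT : ∀ n : ℕ, n₀ ≤ n → UnitTiltAt (F.refine n) (γ * ((F.L : ℝ)⁻¹) ^ n) b₀ p₀ 0)
    (hM : ∃ δ : ℕ → ℝ, Tendsto δ atTop (𝓝 0) ∧ ∀ n K : ℕ, n₀ ≤ n →
      (gibbsK (F.refine n) ℰp (γ * ((F.L : ℝ)⁻¹) ^ n) K).real
        (histGood (F.refine n) ℰp (θBal (F.refine n).L (γ * ((F.L : ℝ)⁻¹) ^ n) b₀ p₀) K 0)ᶜ ≤ δ n) :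
    ∃ ν : Measure (GaugeField (F.P 0) 0 (Matrix.specialUnitaryGroup (Fin 2) ℂ)), IsProbabilityMeasure ν ∧
      ν ≪ fieldMeasure (F.P 0) 0 (Matrix.specialUnitaryGroup (Fin 2) ℂ) ∧
      (∀ ε : ℝ, 0 < ε → ∃ J₀ : ℕ, ∀ J : ℕ, J₀ ≤ J →
        ∀ g : GaugeField (F.P 0) 0 (Matrix.specialUnitaryGroup (Fin 2) ℂ) → ℝ, Measurable g → (∀ u, |g u| ≤ 1) →
          |(∫ u, g u ∂F.unitLaw ℰp measurableE_ℰp γ J) - ∫ u, g u ∂ν| ≤ ε) ∧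
      (∀ v : GaugeTransf (F.P 0) 0 (Matrix.specialUnitaryGroup (Fin 2) ℂ), ν.map (GaugeField.gaugeAct v) = ν) ∧
      (∀ z : Matrix.specialUnitaryGroup (Fin 2) ℂ, (∀ g : Matrix.specialUnitaryGroup (Fin 2) ℂ, z * g = g * z) →
        ∀ (μ : Fin 3) (s : ZMod ((F.P 0).sitesPerDir 0)), ν.map (GaugeField.ctwist z μ s) = ν) ∧
      ∀ ν' : Measure (GaugeField (F.P 0) 0 (Matrix.specialUnitaryGroup (Fin 2) ℂ)), IsFiniteMeasure ν' →
        (∀ ε : ℝ, 0 < ε → ∃ J₀ : ℕ, ∀ J : ℕ, J₀ ≤ J →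
          ∀ g : GaugeField (F.P 0) 0 (Matrix.specialUnitaryGroup (Fin 2) ℂ) → ℝ, Measurable g → (∀ u, |g u| ≤ 1) →
            |(∫ u, g u ∂F.unitLaw ℰp measurableE_ℰp γ J) - ∫ u, g u ∂ν'| ≤ ε) → ν' = ν := by
  obtain ⟨ρl, _, _, _, hP, hTV⟩ := exists_limitUnitLaw_TV F n₀ hγ hT hM
  refine ⟨_, hP, withDensity_absolutelyContinuous _ _, hTV,
    fun v => map_gaugeAct_eq_of_tvLimit F hγ.le hTV v,
    fun z hz μ s => map_ctwist_eq_of_tvLimit F hγ.le hTV hz μ s,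
    fun ν' hν' hTV' => ?_⟩
  exact eq_of_tvLimit (fun J => F.unitLaw ℰp measurableE_ℰp γ J) hTV' hTV

end UnitLaw

end Summit.QuantumFields.YangMills.Theorems.WideningTVSym

end
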